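import Literature.MathematicalPhysics.QuantumFieldTheory.Balaban1983to89.B1Eq324BenfattoEq324Signed
import HarnessLib

/-!
# `Balaban1983to89.B1Eq324BenfattoEq324UnitRange` — [Balaban1982Higgs1] (3.24) p. 616, the `η`-bookkeeping of `…B1Eq324BenfattoSpecialisation` ∕ `…Eq324Signed` on the WHOLE
# coupling range `(0, 1]` (not only `η ≤ η₀`): PROVED real analysis; no new definition, no fact asserted

statement-level companion of a published source with citation tags; every declaration here is a theorem; nothing here is
a claim about the Yang–Mills mass gap

WHY THIS MODULE (cell `pub-ymgap`, seat `dag-n08-w4` gen 5, CLAIM-7; node N08 [Balaban1985UV3]; the Literature twin of §1–§2 of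
`Summits/QuantumFields/YangMills/Theorems/BalabanUVNodesN08AlphaEq324RowClassSocketAllSteps.lean` (p635642), so that the CLASS ROAD's theorems
(`…KernelEq324.eq324_of_classSigned(_noPad)`, `eq324_kernel_noPad`, `…KernelEq324AnyGamma.eq324_kernel_of_expDecay`), which sit under `Literature/` and cannot
import `Summits/`, can be re-issued for EVERY coupling `η ∈ (0, 1]` by swapping ONE lemma name).  `…Specialisation.errTerm_pFun_le` bounds the printed error per
unit volume `errTerm S ρ₁ ρ₂ ρ₃ ρ₄ A (p η) t ≤ C·η^κ` only for `η ≤ η₀` (the large-field term is compared with `η^κ` for small `η`); `…Eq324Signed.eq324_of_sandwich_consts`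
inherits `η ≤ η₀`.  [Balaban1985UV3] consumes (3.24) at EVERY renormalization step, i.e. at every running coupling `g_k ∈ (0, g√ε₀] ⊆ (0, 1]` (the cell normalises the
smallness threshold to `1`).  On `[η₀, 1]` the error is simply BOUNDED (`b = p(η) ∈ [b₀, p(η₀)]`, `A ≤ c·η^σ ≤ c`), so the bookkeeping holds on all of `(0, 1]` with a
larger constant.  What is NOT automatic is the supplier's threshold condition `b* < p(η)`; since `p(η) ≥ p(1) = b₀` it holds on `(0, 1]` as soon as `b* < b₀` — print's
«b₀ is a sufficiently large absolute constant» ((7) p. 257), displayed below as the hypothesis `hbw`.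
* `errTerm_pFun_le_on_unit` — `∃ C ≥ 0, ∀ η ∈ (0, 1], ∀ A ∈ [0, c·η^σ]: errTerm … (p η) t ≤ C·η^κ` (every `0 < κ < σ(t+1)`).
* `lt_pFun_of_lt_b₀` — `b* < b₀`, `0 ≤ p₀` ⇒ `b* < p(η)` on `(0, 1]`.
* ★ `pos_and_abs_log_le_of_sandwich_on_unit` — `eq324_of_sandwich_consts` WITHOUT `η₀` and WITHOUT `b*`: for every `η ∈ (0, 1]`, any measure, any instance, the two-sided
  sandwich at `b = p(η)` gives `0 < ∫Πχ̂_{p(η)}e^{H_J}dμ ∧ |log ∫ − cumulantSum μ H_J t| ≤ C·η^κ·|I|`.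
* ★ `eq324_of_sandwich_consts_on_unit` — the DROP-IN edition: under `hbw : b* < b₀`, literally `eq324_of_sandwich_consts`' conclusion with `η₀ := 1`
  (`∃ η₀ C, 0 < η₀ ∧ η₀ ≤ 1 ∧ 0 ≤ C ∧ ∀ η ≤ η₀, b* < p(η) ∧ …`) AND `η₀ = 1` recorded — consumers swap the lemma name and gain the whole range.
HONEST SCOPE.  Real analysis over the typed letters `errTerm`, `B10.pFun`; nothing of [Balaban1982Higgs1] ∕ [BenfattoEtAl1978] ∕ [Balaban1985UV3] asserted; count-neutral for
N08; nothing about d = 4, the continuum, OS axioms, a mass gap or the Clay problem.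
-/

noncomputable section

open MeasureTheory Finset

namespace Literature.MathematicalPhysics.QuantumFieldTheory.Balaban1983to89.B1Eq324BenfattoEq324UnitRange

open Literature.MathematicalPhysics.QuantumFieldTheory.Balaban1983to89.B1Eq324BenfattoLemma
open Literature.MathematicalPhysics.QuantumFieldTheory.Balaban1983to89.B1Eq324BenfattoSpecialisation
open Literature.MathematicalPhysics.QuantumFieldTheory.Balaban1983to89.B1Eq324BenfattoEq324Signed (pos_and_abs_log_sub_le_of_sandwich)

variable {d : ℕ}

/-! ## §1  The printed error per unit volume on the whole range `(0, 1]` -/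

/-- For `1 ≤ ℓ ≤ ℓ₁` and any real exponent: `ℓ^x ≤ ℓ₁^{|x|}`. [folklore] -/
private theorem rpow_le_rpow_abs_of_le {ℓ ℓ₁ : ℝ} (h1 : 1 ≤ ℓ) (h2 : ℓ ≤ ℓ₁) (x : ℝ) : ℓ ^ x ≤ ℓ₁ ^ |x| := by
  rcases le_or_gt 0 x with hx | hx
  · rw [abs_of_nonneg hx]
    exact Real.rpow_le_rpow (zero_le_one.trans h1) h2 hx
  · calc ℓ ^ x ≤ 1 := Real.rpow_le_one_of_one_le_of_nonpos h1 hx.le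
      _ ≤ ℓ₁ ^ |x| := Real.one_le_rpow (h1.trans h2) (abs_nonneg x)

/-- ★★ **THE `η`-BOOKKEEPING OF (3.24) ON THE WHOLE RANGE `(0, 1]`.**  With the coefficient bound `0 ≤ A ≤ c·η^σ` and the threshold `b = p(η) = b₀(1 + log η⁻¹)^{p₀}`, the
printed error per unit volume satisfies `errTerm S ρ₁ ρ₂ ρ₃ ρ₄ A (p η) t ≤ C·η^κ` for ALL `η ∈ (0, 1]` and every `0 < κ < σ(t+1)` (`S ≥ 0`, `ρ₃ > 0`, `b₀ > 0`, `p₀ > 2∕3`, `σ > 0`,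
`c ≥ 0`).  (`errTerm_pFun_le` on `(0, η₀]`; on `[η₀, 1]` the error is bounded — `p(η)^ρ = b₀^ρ(1 + log η⁻¹)^{p₀ρ} ≤ b₀^ρ(1 + log η₀⁻¹)^{|p₀ρ|}`, `A ≤ c`, `e^{−ρ₃ b^{3∕2}} ≤ 1` — and
`η^κ ≥ η₀^κ`.)  A Summits-side twin, `Summit.QuantumFields.YangMills.Theorems.BalabanUVNodesN08AlphaEq324RowClassSocketAllSteps.errTerm_pFun_le_on_unit`, is not importable
under `Literature/`. [cite: Balaban1982Higgs1, (3.24) p.616; BenfattoEtAl1978, (4.6)–(4.7) p.152, Remark 4 p.153] -/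
theorem errTerm_pFun_le_on_unit {S ρ₃ b₀ p₀ σ c κ : ℝ} (ρ₁ ρ₂ ρ₄ : ℝ) (t : ℕ) (hS : 0 ≤ S) (hρ₃ : 0 < ρ₃) (hb₀ : 0 < b₀)
    (hp₀ : 2 / 3 < p₀) (hσ : 0 < σ) (hc : 0 ≤ c) (hκ : 0 < κ) (hκσ : κ < σ * (t + 1)) :
    ∃ C : ℝ, 0 ≤ C ∧ ∀ η A : ℝ, 0 < η → η ≤ 1 → 0 ≤ A → A ≤ c * η ^ σ →
      errTerm S ρ₁ ρ₂ ρ₃ ρ₄ A (B10.pFun b₀ p₀ η) t ≤ C * η ^ κ := by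
  obtain ⟨η₀, C₀, hη₀, hη₀1, hC₀, h₀⟩ := errTerm_pFun_le ρ₁ ρ₂ ρ₄ t hS hρ₃ hb₀ hp₀ hσ hc hκ hκσ
  -- constants for the range `η ∈ [η₀, 1]`
  set ℓ₁ : ℝ := 1 + Real.log η₀⁻¹ with hℓ₁
  have hℓ₁1 : 1 ≤ ℓ₁ := by rw [hℓ₁]; linarith [B10.log_inv_nonneg_of_le_one hη₀ hη₀1]
  have hℓ₁0 : 0 < ℓ₁ := lt_of_lt_of_le one_pos hℓ₁1
  have hb1 : 0 < b₀ ^ ρ₁ := Real.rpow_pos_of_pos hb₀ _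
  have hb3 : 0 < b₀ ^ ρ₃ := Real.rpow_pos_of_pos hb₀ _
  have hl1 : 0 < ℓ₁ ^ |p₀ * ρ₁| := Real.rpow_pos_of_pos hℓ₁0 _
  have hl3 : 0 < ℓ₁ ^ |p₀ * ρ₃| := Real.rpow_pos_of_pos hℓ₁0 _
  set B₁ : ℝ := b₀ ^ ρ₁ * ℓ₁ ^ |p₀ * ρ₁| with hB₁
  set B₃ : ℝ := b₀ ^ ρ₃ * ℓ₁ ^ |p₀ * ρ₃| with hB₃
  have hB₁0 : 0 ≤ B₁ := (mul_pos hb1 hl1).le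
  have hB₃0 : 0 ≤ B₃ := (mul_pos hb3 hl3).le
  set G : ℝ := c * B₃ with hG
  have hG0 : 0 ≤ G := mul_nonneg hc hB₃0
  set M₁ : ℝ := c * B₁ * Real.exp (|ρ₂| * G) with hM₁
  have hM₁0 : 0 ≤ M₁ := mul_nonneg (mul_nonneg hc hB₁0) (Real.exp_pos _).le
  set M : ℝ := S * (M₁ ^ (t + 1) + Real.exp (|ρ₄| * G)) with hM
  have hM0 : 0 ≤ M := mul_nonneg hS (add_nonneg (pow_nonneg hM₁0 _) (Real.exp_pos _).le)
  have hηκ : 0 < η₀ ^ κ := Real.rpow_pos_of_pos hη₀ κ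
  refine ⟨C₀ + M / η₀ ^ κ, add_nonneg hC₀ (div_nonneg hM0 hηκ.le), fun η A hη hη1 hA hAc => ?_⟩
  have hηκ' : 0 ≤ η ^ κ := Real.rpow_nonneg hη.le κ
  rcases le_or_gt η η₀ with hle | hgt
  · calc errTerm S ρ₁ ρ₂ ρ₃ ρ₄ A (B10.pFun b₀ p₀ η) t ≤ C₀ * η ^ κ := h₀ η A hη hle hA hAc
      _ ≤ (C₀ + M / η₀ ^ κ) * η ^ κ := mul_le_mul_of_nonneg_right (le_add_of_nonneg_right (div_nonneg hM0 hηκ.le)) hηκ'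
  · -- the bounded range `η₀ < η ≤ 1`
    have hM' : errTerm S ρ₁ ρ₂ ρ₃ ρ₄ A (B10.pFun b₀ p₀ η) t ≤ M := by
      set ℓ : ℝ := 1 + Real.log η⁻¹ with hℓ
      have hℓ1 : 1 ≤ ℓ := by rw [hℓ]; linarith [B10.log_inv_nonneg_of_le_one hη hη1]
      have hℓℓ₁ : ℓ ≤ ℓ₁ := by
        have : Real.log η⁻¹ ≤ Real.log η₀⁻¹ := by
          rw [Real.log_inv, Real.log_inv]
          exact neg_le_neg (Real.log_le_log hη₀ hgt.le)
        rw [hℓ, hℓ₁]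
        linarith
      set b : ℝ := B10.pFun b₀ p₀ η with hbdef
      have hbpos : 0 < b := pFun_pos_of_le_one hb₀ hη hη1
      have hbρ : ∀ ρ : ℝ, b ^ ρ ≤ b₀ ^ ρ * ℓ₁ ^ |p₀ * ρ| := fun ρ => by
        rw [hbdef, pFun_rpow_eq hb₀ hη hη1 ρ]
        exact mul_le_mul_of_nonneg_left (rpow_le_rpow_abs_of_le hℓ1 hℓℓ₁ _) (Real.rpow_nonneg hb₀.le _)
      have hAc' : A ≤ c := hAc.trans (mul_le_of_le_one_right hc (Real.rpow_le_one hη.le hη1 hσ.le))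
      have hAb3 : A * b ^ ρ₃ ≤ G := mul_le_mul hAc' (hbρ ρ₃) (Real.rpow_nonneg hbpos.le _) hc
      have hAb1 : A * b ^ ρ₁ ≤ c * B₁ := mul_le_mul hAc' (hbρ ρ₁) (Real.rpow_nonneg hbpos.le _) hc
      have hAb30 : 0 ≤ A * b ^ ρ₃ := mul_nonneg hA (Real.rpow_nonneg hbpos.le _)
      have hAb10 : 0 ≤ A * b ^ ρ₁ := mul_nonneg hA (Real.rpow_nonneg hbpos.le _)
      have hexp : ∀ ρ : ℝ, Real.exp (ρ * A * b ^ ρ₃) ≤ Real.exp (|ρ| * G) := fun ρ => by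
        apply Real.exp_le_exp.mpr
        calc ρ * A * b ^ ρ₃ = ρ * (A * b ^ ρ₃) := by ring
          _ ≤ |ρ| * (A * b ^ ρ₃) := mul_le_mul_of_nonneg_right (le_abs_self _) hAb30
          _ ≤ |ρ| * G := mul_le_mul_of_nonneg_left hAb3 (abs_nonneg _)
      have hbase : A * b ^ ρ₁ * Real.exp (ρ₂ * A * b ^ ρ₃) ≤ M₁ :=
        mul_le_mul hAb1 (hexp ρ₂) (Real.exp_pos _).le (mul_nonneg hc hB₁0)
      have hbase0 : 0 ≤ A * b ^ ρ₁ * Real.exp (ρ₂ * A * b ^ ρ₃) := mul_nonneg hAb10 (Real.exp_pos _).le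
      have hpow : (A * b ^ ρ₁ * Real.exp (ρ₂ * A * b ^ ρ₃)) ^ (t + 1) ≤ M₁ ^ (t + 1) := pow_le_pow_left₀ hbase0 hbase _
      have hT2 : Real.exp (-(ρ₃ * b ^ (3 / 2 : ℝ))) * Real.exp (ρ₄ * A * b ^ ρ₃) ≤ Real.exp (|ρ₄| * G) := by
        have h32 : 0 ≤ b ^ (3 / 2 : ℝ) := Real.rpow_nonneg hbpos.le _
        have h1 : Real.exp (-(ρ₃ * b ^ (3 / 2 : ℝ))) ≤ 1 :=
          Real.exp_le_one_iff.mpr (by have := mul_nonneg hρ₃.le h32; linarith)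
        calc Real.exp (-(ρ₃ * b ^ (3 / 2 : ℝ))) * Real.exp (ρ₄ * A * b ^ ρ₃) ≤ 1 * Real.exp (|ρ₄| * G) :=
              mul_le_mul h1 (hexp ρ₄) (Real.exp_pos _).le zero_le_one
          _ = Real.exp (|ρ₄| * G) := one_mul _
      rw [hM]
      unfold errTerm
      exact mul_le_mul_of_nonneg_left (add_le_add hpow hT2) hS
    have hηη₀ : η₀ ^ κ ≤ η ^ κ := Real.rpow_le_rpow hη₀.le hgt.le hκ.le
    calc errTerm S ρ₁ ρ₂ ρ₃ ρ₄ A (B10.pFun b₀ p₀ η) t ≤ M := hM'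
      _ = M / η₀ ^ κ * η₀ ^ κ := (div_mul_cancel₀ M hηκ.ne').symm
      _ ≤ M / η₀ ^ κ * η ^ κ := mul_le_mul_of_nonneg_left hηη₀ (div_nonneg hM0 hηκ.le)
      _ ≤ (C₀ + M / η₀ ^ κ) * η ^ κ := mul_le_mul_of_nonneg_right (le_add_of_nonneg_left hC₀) hηκ'


/-- **The threshold window**: `b* < b₀`, `b₀ > 0`, `p₀ ≥ 0` ⇒ `b* < p(η)` for every `η ∈ (0, 1]` (`p(η) ≥ b₀·1`).  Print: (7) p. 257 «b₀ is a sufficiently large absolute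
constant»; [2] p. 159 «b* = max{10⁴, γ⁻³b̄}» (Summits twin `…RowClassSocketAllSteps.lt_pFun_of_lt_b₀`, not importable here). [cite: Balaban1985UV3, (7) p.257; BenfattoEtAl1978, p.159] -/
theorem lt_pFun_of_lt_b₀ {bstar b₀ p₀ η : ℝ} (hbw : bstar < b₀) (hb₀ : 0 < b₀) (hp₀ : 0 ≤ p₀) (hη : 0 < η) (hη1 : η ≤ 1) :
    bstar < B10.pFun b₀ p₀ η := by
  unfold B10.pFun
  have hu : 1 ≤ 1 + Real.log η⁻¹ := by linarith [B10.log_inv_nonneg_of_le_one hη hη1]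
  have h1 : 1 ≤ (1 + Real.log η⁻¹) ^ p₀ := Real.one_le_rpow hu hp₀
  calc bstar < b₀ := hbw
    _ = b₀ * 1 := (mul_one _).symm
    _ ≤ b₀ * (1 + Real.log η⁻¹) ^ p₀ := mul_le_mul_of_nonneg_left h1 hb₀.le


/-! ## §2  The measure-free consumer of (3.24) on the whole range -/

/-- ★ **[Balaban1982Higgs1] (3.24) — THE `η`-BOOKKEEPING, MEASURE-FREE, ON ALL OF `(0, 1]`** (`…Eq324Signed.eq324_of_sandwich_consts` without `η₀` and without `b*`):
given `S ≥ 0`, `ρ₁, ρ₂, ρ₃ > 0, ρ₄`, `b₀ > 0`, `p₀ > 2∕3`, `σ > 0`, `c ≥ 0`, `t` and `0 < κ < σ(t+1)`, there is `C ≥ 0` such that for EVERY `η ∈ (0, 1]`, every measure `μ`,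
every `s, I, J, a` with `sup|coeff| ≤ c·η^σ`, the two-sided sandwich at `b = p(η)` implies `0 < ∫Π_Δχ̂_{p(η)} e^{H_J} dμ` and
`|log ∫Π_Δχ̂_{p(η)} e^{H_J} dμ − Σ_{k≤t}ℰ_μᵀ(H_J;k)∕k!| ≤ C·η^κ·|I|` (Summits twin `…RowClassSocketAllSteps.pos_and_abs_log_le_of_sandwich_on_unit`, not importable
here). [cite: Balaban1982Higgs1, (3.24) p.616; BenfattoEtAl1978, Lemma p.152, Remark 4 p.153] -/
theorem pos_and_abs_log_le_of_sandwich_on_unit {t D : ℕ} {ϰ S ρ₁ ρ₂ ρ₃ ρ₄ b₀ p₀ σ c κ : ℝ}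
    (hS : 0 ≤ S) (hρ₃ : 0 < ρ₃) (hb₀ : 0 < b₀) (hp₀ : 2 / 3 < p₀) (hσ : 0 < σ) (hc : 0 ≤ c) (hκ : 0 < κ) (hκσ : κ < σ * (t + 1)) :
    ∃ C : ℝ, 0 ≤ C ∧ ∀ η : ℝ, 0 < η → η ≤ 1 →
      ∀ (μ : Measure ((Fin d → ℤ) → ℝ)) (s : ℕ) (I J : Finset (Fin d → ℤ)) (a : Coef d), coefSup s D a J ≤ c * η ^ σ →
        Real.exp (cumulantSum μ (hamiltonian s D ϰ a J) t -
              (I.card : ℝ) * errTerm S ρ₁ ρ₂ ρ₃ ρ₄ (coefSup s D a J) (B10.pFun b₀ p₀ η) t) ≤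
            ∫ z, cutoffBoltzmann (hamiltonian s D ϰ a J) I (B10.pFun b₀ p₀ η) z ∂μ →
        ∫ z, cutoffBoltzmann (hamiltonian s D ϰ a J) I (B10.pFun b₀ p₀ η) z ∂μ ≤
            Real.exp (cumulantSum μ (hamiltonian s D ϰ a J) t +
              (I.card : ℝ) * errTerm S ρ₁ ρ₂ ρ₃ ρ₄ (coefSup s D a J) (B10.pFun b₀ p₀ η) t) →
        0 < ∫ z, cutoffBoltzmann (hamiltonian s D ϰ a J) I (B10.pFun b₀ p₀ η) z ∂μ ∧
          |Real.log (∫ z, cutoffBoltzmann (hamiltonian s D ϰ a J) I (B10.pFun b₀ p₀ η) z ∂μ) -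
              cumulantSum μ (hamiltonian s D ϰ a J) t| ≤ C * η ^ κ * I.card := by
  obtain ⟨C, hC, hE⟩ := errTerm_pFun_le_on_unit ρ₁ ρ₂ ρ₄ t hS hρ₃ hb₀ hp₀ hσ hc hκ hκσ
  refine ⟨C, hC, fun η hη hη1 μ s I J a hA hlow hup => ?_⟩
  obtain ⟨hpos, hsand⟩ := pos_and_abs_log_sub_le_of_sandwich hlow hup
  refine ⟨hpos, hsand.trans ?_⟩
  have herr := hE η (coefSup s D a J) hη hη1 (coefSup_nonneg s D a J) hA
  calc (I.card : ℝ) * errTerm S ρ₁ ρ₂ ρ₃ ρ₄ (coefSup s D a J) (B10.pFun b₀ p₀ η) t ≤ (I.card : ℝ) * (C * η ^ κ) :=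
        mul_le_mul_of_nonneg_left herr (Nat.cast_nonneg _)
    _ = C * η ^ κ * I.card := by ring

/-- ★ **THE DROP-IN EDITION of `…Eq324Signed.eq324_of_sandwich_consts` ON THE WHOLE RANGE**, under the threshold window `b* < b₀`: the SAME conclusion shape
(`∃ η₀ C, 0 < η₀ ∧ η₀ ≤ 1 ∧ 0 ≤ C ∧ ∀ η ∈ (0, η₀], b* < p(η) ∧ …`) with, in addition, `η₀ = 1` — so `eq324_of_classSigned(_noPad)` ∕ `eq324_kernel_*` re-issue for every
coupling by swapping the lemma name. [cite: Balaban1982Higgs1, (3.24) p.616; Balaban1985UV3, (7) p.257; BenfattoEtAl1978, Lemma p.152, p.159] -/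
theorem eq324_of_sandwich_consts_on_unit {t D : ℕ} {ϰ bstar S ρ₁ ρ₂ ρ₃ ρ₄ b₀ p₀ σ c κ : ℝ}
    (hS : 0 ≤ S) (hρ₃ : 0 < ρ₃) (hb₀ : 0 < b₀) (hp₀ : 2 / 3 < p₀) (hσ : 0 < σ) (hc : 0 ≤ c) (hκ : 0 < κ) (hκσ : κ < σ * (t + 1))
    (hbw : bstar < b₀) :
    ∃ η₀ C : ℝ, 0 < η₀ ∧ η₀ ≤ 1 ∧ 0 ≤ C ∧ η₀ = 1 ∧ ∀ η : ℝ, 0 < η → η ≤ η₀ →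
      bstar < B10.pFun b₀ p₀ η ∧
      ∀ (μ : Measure ((Fin d → ℤ) → ℝ)) (s : ℕ) (I J : Finset (Fin d → ℤ)) (a : Coef d), coefSup s D a J ≤ c * η ^ σ →
        Real.exp (cumulantSum μ (hamiltonian s D ϰ a J) t -
              (I.card : ℝ) * errTerm S ρ₁ ρ₂ ρ₃ ρ₄ (coefSup s D a J) (B10.pFun b₀ p₀ η) t) ≤
            ∫ z, cutoffBoltzmann (hamiltonian s D ϰ a J) I (B10.pFun b₀ p₀ η) z ∂μ →
        ∫ z, cutoffBoltzmann (hamiltonian s D ϰ a J) I (B10.pFun b₀ p₀ η) z ∂μ ≤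
            Real.exp (cumulantSum μ (hamiltonian s D ϰ a J) t +
              (I.card : ℝ) * errTerm S ρ₁ ρ₂ ρ₃ ρ₄ (coefSup s D a J) (B10.pFun b₀ p₀ η) t) →
        0 < ∫ z, cutoffBoltzmann (hamiltonian s D ϰ a J) I (B10.pFun b₀ p₀ η) z ∂μ ∧
          |Real.log (∫ z, cutoffBoltzmann (hamiltonian s D ϰ a J) I (B10.pFun b₀ p₀ η) z ∂μ) -
              cumulantSum μ (hamiltonian s D ϰ a J) t| ≤ C * η ^ κ * I.card := by
  obtain ⟨C, hC, hE⟩ :=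
    pos_and_abs_log_le_of_sandwich_on_unit (d := d) (D := D) (ϰ := ϰ) (ρ₁ := ρ₁) (ρ₂ := ρ₂) (ρ₄ := ρ₄) hS hρ₃ hb₀ hp₀ hσ hc hκ hκσ
  refine ⟨1, C, one_pos, le_rfl, hC, rfl, fun η hη hη1 => ⟨?_, fun μ s I J a hA hlow hup => hE η hη hη1 μ s I J a hA hlow hup⟩⟩
  exact lt_pFun_of_lt_b₀ hbw hb₀ (by linarith) hη hη1

end Literature.MathematicalPhysics.QuantumFieldTheory.Balaban1983to89.B1Eq324BenfattoEq324UnitRange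

end
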